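import Mathlib
import Literature.Computability.AlgebraicComplexity.ReadOnceFormulas

/-!
# The single-seed Shpilka–Volkovich generator hits every preprocessed read-once polynomial
(Minahan–Volkovich 2017, Thm. 20), in abstract form

Minahan–Volkovich prove that the Shpilka–Volkovich map with ONE seed,
`G_{n,1}(y, z) = (L_1(y) z, …, L_n(y) z)` (`L_i` the Lagrange interpolation polynomials of `n`
distinct nodes `α_1, …, α_n`), is a generator for preprocessed read-once polynomials (PROPs): for
every non-constant PROP `P`, `P(G_{n,1})` is non-constant (CCC 2017, Thm. 20; this is the heart of
their polynomial-size hitting set for read-once formulas, Thm. 1). The proof is an induction over the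
read-once structure (Lemma 13): products of non-constant polynomials are non-constant, and for a sum
`P₁ + P₂` of VARIABLE-DISJOINT PROPs the `z^k`-coefficients cannot cancel — for the Lagrange family
this is a divisibility / degree count (Lemma 18 and the display after (2) on p. 32:9).

We record the theorem in the following ABSTRACT form, which isolates exactly what the argument uses
of the seed coordinates `c_μ ∈ A` (`A` any domain over the field `F`):

* `SeparatesDisjointForms F c` : for `k ≥ 1` and homogeneous `k`-forms `Q₁`, `Q₂` over `F` in
  DISJOINT sets of variables, `Q₁(c) + Q₂(c) = 0` forces `Q₁(c) = 0` ("no non-zero value of a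
  `k`-form in the coordinates `c_{V₁}` is a value of a `k`-form in `c_{V₂}`, `V₁ ∩ V₂ = ∅`");
* `IsPROP.exists_C_of_aeval_singleSeed_eq_C` : if all `c_μ ≠ 0` and `c` separates disjoint
  forms, then for every PROP `P` (tree predicate `IsPROP`, Minahan–Volkovich Def. 12) and every
  shift `y : ι → F`, `P(y_μ + W · c_μ) ∈ A[W]` constant ⟹ `P` constant; hence
  `IsPROP.aeval_singleSeed_ne_zero` : `P ≠ 0 ⟹ P(y + W · c) ≠ 0`;
* `separatesDisjointForms_lagrangeSeed` : Minahan–Volkovich's family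
  `L_μ = ∏_{ν ≠ μ} (X − α_ν) ∈ F[X]` (= Mathlib's `Lagrange.basis univ α μ` up to the non-zero
  constant `Lagrange.nodalWeight`, `lagrangeSeed_eq`) separates disjoint forms when `α` is
  injective — the divisibility argument of Thm. 20: writing `Φ_T = ∏_{ν ∈ T} (X − α_ν)`
  (`Lagrange.nodal`), a `k`-form in `L_{V₁}` equals `Φ_{∁V₁}^k · A'` with `deg A' ≤ k (|V₁| − 1)`,
  and `Φ_{V₂}^k A' = −Φ_{V₁}^k B'` with `gcd(Φ_{V₁}, Φ_{V₂}) = 1` forces `Φ_{V₁}^k ∣ A'`, so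
  `A' = 0`;
* `IsPROP.aeval_lagrangeSingleSeed_ne_zero` : Thm. 20 itself (with an arbitrary affine shift
  `y`, which the source does not need to state since PROPs are translation invariant):
  every non-zero PROP `P` in the variables `ι` satisfies `P(y_μ + W · L_μ(X)) ≠ 0` in `F[X][W]`.

(Bookkeeping lemmas — the translation `x ↦ x + y`, the `W^k`-coefficients as homogeneous
components, the factorisation `L_μ = Φ_{∁V} Φ_{V∖μ}` and the cofactor sum `A'` — live in the
sub-namespace `SingleSeedGenerator`.) The shift `y` and the scaling variable `W` are kept explicit because that is the form in which the
generator is consumed by succinct-generator arguments (Forbes–Shpilka–Volk 2018, Construction 25: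
`Γ_μ = coeff_μ f₀ + W · L_μ`). Valid over any field `F` admitting the injective node map `α`
(no characteristic hypothesis). What is NOT here: the hitting SET extracted from the generator
(Minahan–Volkovich Lemma 16 / Thm. 1), sums of `k` PROPs (their Cor. 22), reconstruction (Thm. 3).

References: [MinahanVolkovich2017] D. Minahan, I. Volkovich, *Complete derandomization of identity
testing and reconstruction of read-once formulas*, CCC 2017 (LIPIcs 79) 32, Def. 12, Lemma 13,
Lemma 18, Lemma 19, Thm. 20 (journal version ACM ToCT 10 (2018) no. 3);
[ShpilkaVolkovich2015] A. Shpilka, I. Volkovich, Comput. Complexity 24 (2015) 477–532 (the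
generator `G_{n,t}`); [ForbesShpilkaVolk2018] M. Forbes, A. Shpilka, B. L. Volk, Theory Comput. 14
(2018), Construction 25 (succinct form of the generator).
-/

namespace Literature.Computability.AlgebraicComplexity

open MvPolynomial

/-! ### The abstract criterion and the single-seed map -/

section Abstract

variable (F : Type*) [Field F] {A : Type*} [CommRing A] [Algebra F A] {ι : Type*}

/-- **Separation of disjoint forms** (the property of the seed coordinates `c_μ ∈ A` used by
Minahan–Volkovich's induction, abstracted from their Lemma 18 / proof of Thm. 20): for every `k ≥ 1`
and all homogeneous `k`-forms `Q₁`, `Q₂` over `F` in DISJOINT sets of variables,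
`Q₁(c) + Q₂(c) = 0` implies `Q₁(c) = 0` — no non-zero value of a `k`-form in the coordinates
`{c_μ : μ ∈ V₁}` is the value of a `k`-form in `{c_μ : μ ∈ V₂}` when `V₁ ∩ V₂ = ∅`.
[cite: MinahanVolkovich2017, Lemma 18 and proof of Thm. 20] -/
def SeparatesDisjointForms (c : ι → A) : Prop :=
  ∀ k : ℕ, 0 < k → ∀ Q₁ Q₂ : MvPolynomial ι F, Q₁.IsHomogeneous k → Q₂.IsHomogeneous k →
    Disjoint Q₁.vars Q₂.vars → aeval c Q₁ + aeval c Q₂ = 0 → aeval c Q₁ = 0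

variable {F}

/-- **The single-seed map** `x_μ ↦ y_μ + W · c_μ ∈ A[W]`: one seed `W` scaling the coordinates
`c_μ`, shifted by the constant point `y` (Shpilka–Volkovich's `G_{n,1}` composed with a translation;
Forbes–Shpilka–Volk's succinct form `Γ_μ = coeff_μ f₀ + W · L_μ`).
[cite: MinahanVolkovich2017, Def. 14 (t = 1)] -/
noncomputable def singleSeed (y : ι → F) (c : ι → A) (μ : ι) : Polynomial A :=
  Polynomial.C (c μ) * Polynomial.X + Polynomial.C (algebraMap F A (y μ))

namespace SingleSeedGenerator

/-- The pure scaling map `x_μ ↦ W · c_μ` (no shift). [cite: MinahanVolkovich2017, Def. 14 (t = 1)] -/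
noncomputable def scaledSeed (c : ι → A) (μ : ι) : Polynomial A :=
  Polynomial.C (c μ) * Polynomial.X

/-- The translation `x_μ ↦ x_μ + y_μ` of `F[x]`, an `F`-algebra endomorphism. [folklore] -/
noncomputable def translate (y : ι → F) : MvPolynomial ι F →ₐ[F] MvPolynomial ι F :=
  aeval fun μ => X μ + C (y μ)

/-- The single-seed map is the scaling map after the translation: `P(y + W c) = P(x + y)|_{x = W c}`.
[folklore] -/
private theorem aeval_singleSeed_eq (y : ι → F) (c : ι → A) (P : MvPolynomial ι F) :
    aeval (singleSeed y c) P = aeval (scaledSeed c) (translate y P) := by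
  have h : (fun μ => aeval (scaledSeed c) (X μ + C (y μ))) = singleSeed y c := by
    funext μ
    simp only [map_add, aeval_X, aeval_C, Polynomial.algebraMap_apply, singleSeed, scaledSeed]
  rw [translate, ← AlgHom.comp_apply, MvPolynomial.comp_aeval, h]

/-- The variables of the translated polynomial are among those of the original. [folklore] -/
private theorem vars_translate_subset [DecidableEq ι] (y : ι → F) (P : MvPolynomial ι F) :
    (translate y P).vars ⊆ P.vars := by
  have h : translate y P = bind₁ (fun μ => X μ + C (y μ)) P := rfl
  rw [h]
  refine (vars_bind₁ _ _).trans (Finset.biUnion_subset.mpr fun μ hμ => ?_)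
  refine (vars_add_subset _ _).trans ?_
  rw [vars_X, vars_C, Finset.union_empty]
  exact Finset.singleton_subset_iff.mpr hμ

/-- The variables of a homogeneous component are among those of the polynomial. [folklore] -/
private theorem vars_homogeneousComponent_subset [DecidableEq ι] (k : ℕ) (Q : MvPolynomial ι F) :
    (homogeneousComponent k Q).vars ⊆ Q.vars := by
  intro μ hμ
  rw [mem_vars_iff_mem_support] at hμ ⊢
  obtain ⟨d, hd, hμd⟩ := hμ
  refine ⟨d, ?_, hμd⟩
  rw [mem_support_iff, coeff_homogeneousComponent] at hd
  rw [mem_support_iff]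
  by_cases h : d.degree = k
  · rwa [if_pos h] at hd
  · rw [if_neg h] at hd
    exact (hd rfl).elim

/-- **The `W^k`-coefficient of `Q(W · c)` is the value at `c` of the degree-`k` homogeneous
component of `Q`** (the bookkeeping behind Minahan–Volkovich's Lemma 18: `m(G_{n,1}) = z^d · …`
for a monomial of degree `d`). [cite: MinahanVolkovich2017, Lemma 18] -/
theorem coeff_aeval_scaledSeed (c : ι → A) (Q : MvPolynomial ι F) (k : ℕ) :
    (aeval (scaledSeed c) Q).coeff k = aeval c (homogeneousComponent k Q) := by
  classical
  rw [MvPolynomial.aeval_def, MvPolynomial.eval₂_eq, homogeneousComponent_apply, map_sum,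
    Polynomial.finsetSum_coeff, Finset.sum_filter]
  refine Finset.sum_congr rfl fun d _ => ?_
  have hprod : ∏ i ∈ d.support, (scaledSeed c i) ^ d i =
      Polynomial.C (∏ i ∈ d.support, c i ^ d i) * Polynomial.X ^ d.degree := by
    rw [Finsupp.degree_apply, ← Finset.prod_pow_eq_pow_sum, map_prod, ← Finset.prod_mul_distrib]
    refine Finset.prod_congr rfl fun i _ => ?_
    rw [scaledSeed, mul_pow, map_pow]
  rw [hprod, Polynomial.algebraMap_apply, ← mul_assoc, ← map_mul, Polynomial.coeff_C_mul_X_pow]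
  by_cases h : d.degree = k
  · rw [if_pos h.symm, if_pos h, aeval_monomial, Finsupp.prod]
  · rw [if_neg (Ne.symm h), if_neg h]

variable [IsDomain A]

/-- A leaf: for a univariate `T` over `F` and `c_μ ≠ 0`, the polynomial `T(y_μ + W c_μ) ∈ A[W]` has
the same degree as `T` (so it is constant only if `T` is). [cite: MinahanVolkovich2017, Lemma 19] -/
theorem natDegree_aeval_singleSeed_leaf (y : ι → F) {c : ι → A} {μ : ι} (hc : c μ ≠ 0)
    (T : Polynomial F) :
    (Polynomial.aeval (singleSeed y c μ) T).natDegree = T.natDegree := by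
  have hinj : Function.Injective (algebraMap F A) := (algebraMap F A).injective
  rw [← Polynomial.aeval_map_algebraMap A, ← Polynomial.comp_eq_aeval, Polynomial.natDegree_comp,
    Polynomial.natDegree_map_eq_of_injective hinj, singleSeed, Polynomial.natDegree_add_C,
    Polynomial.natDegree_C_mul_X _ hc, mul_one]

end SingleSeedGenerator

open SingleSeedGenerator

variable [IsDomain A]

/-- **Minahan–Volkovich's Theorem 20, abstract form.** If the seed coordinates `c_μ ∈ A` (a domain
over `F`) are all non-zero and separate disjoint forms, then a preprocessed read-once polynomial `P`
whose single-seed image `P(y + W · c) ∈ A[W]` is a constant is itself a constant. Induction over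
the read-once structure (`IsPROP`): a leaf `T(x_μ)` keeps its degree
(`natDegree_aeval_singleSeed_leaf`); a product of two polynomials over a domain is constant only if
both are (or one vanishes, and then it is the constant `0`); for a sum `P₁ + P₂` on DISJOINT leaf
sets the `W^k`-coefficients (`k ≥ 1`) are values of the degree-`k` components of the translated
`P₁`, `P₂` — `k`-forms in disjoint variables (`coeff_aeval_scaledSeed`, `vars_translate_subset`,
`IsPROP.vars_subset`) — so they cannot cancel by `SeparatesDisjointForms`.
[cite: MinahanVolkovich2017, Thm. 20] -/
theorem IsPROP.exists_C_of_aeval_singleSeed_eq_C [DecidableEq ι] {c : ι → A}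
    (hc : ∀ μ, c μ ≠ 0) (hsep : SeparatesDisjointForms F c) (y : ι → F) {S : Finset ι}
    {P : MvPolynomial ι F} (hP : IsPROP S P) :
    ∀ a : A, aeval (singleSeed y c) P = Polynomial.C a → ∃ b : F, P = C b := by
  induction hP with
  | const b => exact fun _ _ => ⟨b, rfl⟩
  | leaf μ T =>
      intro a ha
      rw [← Polynomial.aeval_algHom_apply, aeval_X] at ha
      have hdeg := natDegree_aeval_singleSeed_leaf y (hc μ) T
      rw [ha, Polynomial.natDegree_C] at hdeg
      refine ⟨T.coeff 0, ?_⟩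
      conv_lhs => rw [Polynomial.eq_C_of_natDegree_eq_zero hdeg.symm]
      rw [Polynomial.aeval_C, MvPolynomial.algebraMap_eq]
  | @add S₁ S₂ P₁ P₂ h₁ h₂ hdisj ih₁ ih₂ =>
      intro a ha
      rw [map_add] at ha
      -- the `W^k`-coefficients of `P₁(y + W c)` vanish for `k ≥ 1`
      have hcoeff : ∀ k, 0 < k → (aeval (singleSeed y c) P₁).coeff k = 0 := by
        intro k hk
        have hsum : (aeval (singleSeed y c) P₁).coeff k + (aeval (singleSeed y c) P₂).coeff k = 0 := by
          rw [← Polynomial.coeff_add, ha, Polynomial.coeff_C, if_neg hk.ne']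
        rw [aeval_singleSeed_eq, aeval_singleSeed_eq, coeff_aeval_scaledSeed,
          coeff_aeval_scaledSeed] at hsum
        rw [aeval_singleSeed_eq, coeff_aeval_scaledSeed]
        refine hsep k hk _ _ (homogeneousComponent_isHomogeneous k _)
          (homogeneousComponent_isHomogeneous k _) ?_ hsum
        exact Finset.disjoint_of_subset_left
          ((vars_homogeneousComponent_subset k _).trans
            ((vars_translate_subset y P₁).trans h₁.vars_subset))
          (Finset.disjoint_of_subset_right
            ((vars_homogeneousComponent_subset k _).trans
              ((vars_translate_subset y P₂).trans h₂.vars_subset)) hdisj)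
      have hP₁C : aeval (singleSeed y c) P₁ = Polynomial.C ((aeval (singleSeed y c) P₁).coeff 0) := by
        ext k
        rw [Polynomial.coeff_C]
        rcases Nat.eq_zero_or_pos k with rfl | hk
        · rw [if_pos rfl]
        · rw [if_neg hk.ne', hcoeff k hk]
      obtain ⟨b₁, rfl⟩ := ih₁ _ hP₁C
      have hP₂C : aeval (singleSeed y c) P₂ = Polynomial.C (a - algebraMap F A b₁) := by
        rw [map_sub, ← ha, aeval_C, Polynomial.algebraMap_apply, add_sub_cancel_left]
      obtain ⟨b₂, rfl⟩ := ih₂ _ hP₂C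
      exact ⟨b₁ + b₂, (map_add C b₁ b₂).symm⟩
  | @mul S₁ S₂ P₁ P₂ h₁ h₂ hdisj ih₁ ih₂ =>
      intro a ha
      rw [map_mul] at ha
      -- a vanishing factor is the constant `0`
      have hzero : ∀ {T : Finset ι} {Q : MvPolynomial ι F}, IsPROP T Q →
          (∀ a : A, aeval (singleSeed y c) Q = Polynomial.C a → ∃ b : F, Q = C b) →
          aeval (singleSeed y c) Q = 0 → Q = 0 := by
        intro T Q _ ih hQ
        obtain ⟨b, rfl⟩ := ih 0 (by rw [hQ, map_zero])
        rw [aeval_C, Polynomial.algebraMap_apply, Polynomial.C_eq_zero,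
          map_eq_zero_iff _ (algebraMap F A).injective] at hQ
        rw [hQ, map_zero]
      by_cases hz₁ : aeval (singleSeed y c) P₁ = 0
      · exact ⟨0, by rw [hzero h₁ ih₁ hz₁, zero_mul, map_zero]⟩
      by_cases hz₂ : aeval (singleSeed y c) P₂ = 0
      · exact ⟨0, by rw [hzero h₂ ih₂ hz₂, mul_zero, map_zero]⟩
      -- otherwise both factors have degree `0`
      have hdeg := Polynomial.natDegree_mul hz₁ hz₂
      rw [ha, Polynomial.natDegree_C] at hdeg
      have hd₁ : (aeval (singleSeed y c) P₁).natDegree = 0 := by omega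
      have hd₂ : (aeval (singleSeed y c) P₂).natDegree = 0 := by omega
      obtain ⟨b₁, rfl⟩ := ih₁ _ (Polynomial.eq_C_of_natDegree_eq_zero hd₁)
      obtain ⟨b₂, rfl⟩ := ih₂ _ (Polynomial.eq_C_of_natDegree_eq_zero hd₂)
      exact ⟨b₁ * b₂, (map_mul C b₁ b₂).symm⟩

/-- **Corollary (the generator property).** Under the same hypotheses, a NON-ZERO preprocessed
read-once polynomial does not vanish on the single-seed map: `P ≠ 0 ⟹ P(y + W · c) ≠ 0` — `G_{n,1}`
(shifted by `y`) is a generator for PROPs. [cite: MinahanVolkovich2017, Thm. 20 and Def. 8] -/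
theorem IsPROP.aeval_singleSeed_ne_zero [DecidableEq ι] {c : ι → A} (hc : ∀ μ, c μ ≠ 0)
    (hsep : SeparatesDisjointForms F c) (y : ι → F) {S : Finset ι} {P : MvPolynomial ι F}
    (hP : IsPROP S P) (hP0 : P ≠ 0) : aeval (singleSeed y c) P ≠ 0 := by
  intro h
  obtain ⟨b, rfl⟩ := hP.exists_C_of_aeval_singleSeed_eq_C hc hsep y 0 (by rw [h, map_zero])
  rw [aeval_C, Polynomial.algebraMap_apply, Polynomial.C_eq_zero,
    map_eq_zero_iff _ (algebraMap F A).injective] at h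
  exact hP0 (by rw [h, map_zero])

end Abstract

/-! ### Minahan–Volkovich's instance: the Lagrange family of distinct nodes -/

section Lagrange

open Polynomial Lagrange

variable {F : Type*} [Field F] {ι : Type*} [Fintype ι] [DecidableEq ι]

/-- **Minahan–Volkovich's seed coordinates** `L_μ = ∏_{ν ≠ μ} (X − α_ν) ∈ F[X]` for a node map
`α : ι → F` (Mathlib's `Lagrange.nodal (univ.erase μ) α`; the Lagrange interpolation polynomial of
the node `α_μ` up to the non-zero constant `nodalWeight`, `lagrangeSeed_eq`).
[cite: MinahanVolkovich2017, Def. 14 and Def. 17] -/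
noncomputable def lagrangeSeed (α : ι → F) (μ : ι) : F[X] :=
  nodal (Finset.univ.erase μ) α

/-- `L_μ ≠ 0`. [cite: MinahanVolkovich2017, Def. 14] -/
theorem lagrangeSeed_ne_zero (α : ι → F) (μ : ι) : lagrangeSeed α μ ≠ 0 :=
  nodal_ne_zero

/-- `deg L_μ = |ι| − 1`. [cite: MinahanVolkovich2017, Def. 14] -/
theorem natDegree_lagrangeSeed (α : ι → F) (μ : ι) :
    (lagrangeSeed α μ).natDegree = Fintype.card ι - 1 := by
  rw [lagrangeSeed, natDegree_nodal, Finset.card_erase_of_mem (Finset.mem_univ μ),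
    Finset.card_univ]

/-- Relation to Mathlib's Lagrange basis: `Lagrange.basis univ α μ = C (nodalWeight univ α μ) · L_μ`
(`L_i ∼ Φ_{[n]∖{i}}` in the source's notation). [cite: MinahanVolkovich2017, Def. 17] -/
theorem lagrangeSeed_eq (α : ι → F) (μ : ι) :
    Lagrange.basis Finset.univ α μ =
      Polynomial.C (nodalWeight Finset.univ α μ) * lagrangeSeed α μ := by
  rw [lagrangeSeed, nodal_erase_eq_nodal_div (Finset.mem_univ μ),
    basis_eq_prod_sub_inv_mul_nodal_div (Finset.mem_univ μ)]

/-- The indicator property at the nodes: `L_μ(α_ν) = 0` for `ν ≠ μ`.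
[cite: MinahanVolkovich2017, Def. 14] -/
theorem eval_lagrangeSeed_of_ne (α : ι → F) {μ ν : ι} (h : ν ≠ μ) :
    (lagrangeSeed α μ).eval (α ν) = 0 :=
  eval_nodal_at_node (Finset.mem_erase.mpr ⟨h, Finset.mem_univ ν⟩)

/-- The indicator property at the nodes: `L_μ(α_μ) ≠ 0` when the nodes are distinct.
[cite: MinahanVolkovich2017, Def. 14] -/
theorem eval_lagrangeSeed_self {α : ι → F} (hα : Function.Injective α) (μ : ι) :
    (lagrangeSeed α μ).eval (α μ) ≠ 0 :=
  eval_nodal_not_at_node fun _ hν => fun h => (Finset.mem_erase.mp hν).1 (hα h).symm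

namespace SingleSeedGenerator

omit [Fintype ι] in
/-- The node polynomial of a disjoint union factors: `Φ_{S ∪ T} = Φ_S · Φ_T`.
[cite: MinahanVolkovich2017, Def. 17] -/
theorem nodal_union_of_disjoint (α : ι → F) {S T : Finset ι} (h : Disjoint S T) :
    nodal (S ∪ T) α = nodal S α * nodal T α := by
  rw [nodal, nodal, nodal, Finset.prod_union h]

/-- For `μ ∈ V`: `L_μ = Φ_{∁V} · Φ_{V ∖ μ}`. [cite: MinahanVolkovich2017, proof of Lemma 18] -/
theorem lagrangeSeed_eq_nodal_mul (α : ι → F) {V : Finset ι} {μ : ι} (hμ : μ ∈ V) :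
    lagrangeSeed α μ = nodal (Finset.univ \ V) α * nodal (V.erase μ) α := by
  rw [lagrangeSeed, ← nodal_union_of_disjoint]
  · congr 1
    ext ν
    simp only [Finset.mem_erase, Finset.mem_univ, and_true, Finset.mem_union, Finset.mem_sdiff,
      true_and]
    constructor
    · intro hν
      by_cases hV : ν ∈ V
      · exact Or.inr ⟨hν, hV⟩
      · exact Or.inl hV
    · rintro (hV | ⟨hν, -⟩)
      · exact fun h => hV (h ▸ hμ)
      · exact hν
  · exact Finset.disjoint_of_subset_right (Finset.erase_subset μ V) Finset.sdiff_disjoint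

/-- The cofactor sum `A' = Σ_e q_e ∏_{μ} Φ_{V ∖ μ}^{e_μ}` of a form `Q = Σ_e q_e x^e` in the
variables `V` (Minahan–Volkovich's `P'` of Lemma 18, up to the placement of the constant factors).
[cite: MinahanVolkovich2017, Lemma 18] -/
noncomputable def cofactorSum (α : ι → F) (V : Finset ι) (Q : MvPolynomial ι F) : F[X] :=
  ∑ d ∈ Q.support, Polynomial.C (coeff d Q) * ∏ μ ∈ d.support, nodal (V.erase μ) α ^ d μ

/-- **Lemma 18 (factorisation).** A homogeneous `k`-form `Q` in the variables `V` evaluates on the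
Lagrange family to `Φ_{∁V}^k · A'`. [cite: MinahanVolkovich2017, Lemma 18] -/
theorem aeval_lagrangeSeed_eq (α : ι → F) {V : Finset ι} {Q : MvPolynomial ι F} {k : ℕ}
    (hV : Q.vars ⊆ V) (hQ : Q.IsHomogeneous k) :
    aeval (lagrangeSeed α) Q = nodal (Finset.univ \ V) α ^ k * cofactorSum α V Q := by
  rw [MvPolynomial.aeval_def, MvPolynomial.eval₂_eq, cofactorSum, Finset.mul_sum]
  refine Finset.sum_congr rfl fun d hd => ?_
  have hdeg : ∑ μ ∈ d.support, d μ = k := by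
    rw [← Finsupp.degree_apply, Finsupp.degree_eq_weight_one]
    exact hQ (mem_support_iff.mp hd)
  have hsupp : ∀ μ ∈ d.support, μ ∈ V := fun μ hμ => hV ((mem_vars_iff_mem_support μ).mpr ⟨d, hd, hμ⟩)
  have hprod : ∏ μ ∈ d.support, lagrangeSeed α μ ^ d μ =
      nodal (Finset.univ \ V) α ^ k * ∏ μ ∈ d.support, nodal (V.erase μ) α ^ d μ := by
    rw [← hdeg, ← Finset.prod_pow_eq_pow_sum, ← Finset.prod_mul_distrib]
    refine Finset.prod_congr rfl fun μ hμ => ?_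
    rw [lagrangeSeed_eq_nodal_mul α (hsupp μ hμ), mul_pow]
  rw [hprod, Polynomial.algebraMap_eq, mul_left_comm]

omit [Fintype ι] in
/-- **Lemma 18 (degree bound).** `deg A' ≤ k (|V| − 1)` for a homogeneous `k`-form in the variables
`V`. [cite: MinahanVolkovich2017, Lemma 18] -/
theorem natDegree_cofactorSum_le (α : ι → F) {V : Finset ι} {Q : MvPolynomial ι F} {k : ℕ}
    (hV : Q.vars ⊆ V) (hQ : Q.IsHomogeneous k) :
    (cofactorSum α V Q).natDegree ≤ k * (V.card - 1) := by
  refine Polynomial.natDegree_sum_le_of_forall_le _ _ fun d hd => ?_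
  have hdeg : ∑ μ ∈ d.support, d μ = k := by
    rw [← Finsupp.degree_apply, Finsupp.degree_eq_weight_one]
    exact hQ (mem_support_iff.mp hd)
  have hsupp : ∀ μ ∈ d.support, μ ∈ V := fun μ hμ => hV ((mem_vars_iff_mem_support μ).mpr ⟨d, hd, hμ⟩)
  refine (Polynomial.natDegree_C_mul_le _ _).trans ((Polynomial.natDegree_prod_le _ _).trans ?_)
  rw [← hdeg, Finset.sum_mul]
  refine Finset.sum_le_sum fun μ hμ => (Polynomial.natDegree_pow_le).trans ?_
  rw [natDegree_nodal, Finset.card_erase_of_mem (hsupp μ hμ)]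

omit [Fintype ι] [DecidableEq ι] in
/-- A homogeneous form of positive degree without variables is zero. [folklore] -/
private theorem eq_zero_of_isHomogeneous_of_vars_eq_empty {Q : MvPolynomial ι F} {k : ℕ} (hk : 0 < k)
    (hQ : Q.IsHomogeneous k) (hV : Q.vars = ∅) : Q = 0 := by
  rw [vars_eq_empty_iff_eq_C] at hV
  rw [hV, hQ.coeff_eq_zero (d := 0) (by rw [map_zero]; exact hk.ne), map_zero]

omit [Fintype ι] [DecidableEq ι] in
/-- `Φ_{V₁}` and `Φ_{V₂}` are coprime for disjoint `V₁`, `V₂` and distinct nodes.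
[cite: MinahanVolkovich2017, proof of Thm. 20 ("Φ_{V₁} and Φ_{V₂} have no common roots")] -/
theorem isCoprime_nodal_of_disjoint {α : ι → F} (hα : Function.Injective α) {V₁ V₂ : Finset ι}
    (h : Disjoint V₁ V₂) : IsCoprime (nodal V₁ α) (nodal V₂ α) := by
  rw [nodal, nodal]
  refine IsCoprime.prod_left fun μ hμ => IsCoprime.prod_right fun ν hν => ?_
  exact pairwise_coprime_X_sub_C hα (fun hμν => Finset.disjoint_left.mp h hμ (hμν ▸ hν))

end SingleSeedGenerator

open SingleSeedGenerator

/-- **Minahan–Volkovich's divisibility argument (proof of Thm. 20, case `P = P₁ + P₂`):** for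
distinct nodes the Lagrange family `L_μ = ∏_{ν ≠ μ} (X − α_ν)` separates disjoint forms. With
`W = ∁(V₁ ∪ V₂)`: `Φ_{∁V₁} = Φ_{V₂} Φ_W`, `Φ_{∁V₂} = Φ_{V₁} Φ_W`, so `Q₁(L) + Q₂(L) = 0` reads
`Φ_W^k (Φ_{V₂}^k A' + Φ_{V₁}^k B') = 0`; then `Φ_{V₁}^k ∣ Φ_{V₂}^k A'`, hence `Φ_{V₁}^k ∣ A'` by
coprimality, and `deg A' ≤ k (|V₁| − 1) < k |V₁| = deg Φ_{V₁}^k` forces `A' = 0`.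
[cite: MinahanVolkovich2017, Thm. 20 (proof, display (2) ff.)] -/
theorem separatesDisjointForms_lagrangeSeed {α : ι → F} (hα : Function.Injective α) :
    SeparatesDisjointForms F (lagrangeSeed α) := by
  intro k hk Q₁ Q₂ hQ₁ hQ₂ hdisj hsum
  -- the degenerate case `V₁ = ∅`
  by_cases hV₁ : Q₁.vars = ∅
  · rw [eq_zero_of_isHomogeneous_of_vars_eq_empty hk hQ₁ hV₁, map_zero]
  -- `∁V₁ = V₂ ⊔ W` and `∁V₂ = V₁ ⊔ W` with `W = ∁(V₁ ∪ V₂)`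
  have hc₁ : Finset.univ \ Q₁.vars = Q₂.vars ∪ Finset.univ \ (Q₁.vars ∪ Q₂.vars) := by
    ext ν
    simp only [Finset.mem_sdiff, Finset.mem_univ, true_and, Finset.mem_union, not_or]
    constructor
    · intro h1
      by_cases h2 : ν ∈ Q₂.vars
      · exact Or.inl h2
      · exact Or.inr ⟨h1, h2⟩
    · rintro (h2 | ⟨h1, -⟩)
      · exact Finset.disjoint_right.mp hdisj h2
      · exact h1
  have hc₂ : Finset.univ \ Q₂.vars = Q₁.vars ∪ Finset.univ \ (Q₁.vars ∪ Q₂.vars) := by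
    ext ν
    simp only [Finset.mem_sdiff, Finset.mem_univ, true_and, Finset.mem_union, not_or]
    constructor
    · intro h2
      by_cases h1 : ν ∈ Q₁.vars
      · exact Or.inl h1
      · exact Or.inr ⟨h1, h2⟩
    · rintro (h1 | ⟨-, h2⟩)
      · exact Finset.disjoint_left.mp hdisj h1
      · exact h2
  have hdW₂ : Disjoint Q₂.vars (Finset.univ \ (Q₁.vars ∪ Q₂.vars)) :=
    Finset.disjoint_of_subset_left Finset.subset_union_right Finset.disjoint_sdiff
  have hdW₁ : Disjoint Q₁.vars (Finset.univ \ (Q₁.vars ∪ Q₂.vars)) :=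
    Finset.disjoint_of_subset_left Finset.subset_union_left Finset.disjoint_sdiff
  rw [aeval_lagrangeSeed_eq α subset_rfl hQ₁, aeval_lagrangeSeed_eq α subset_rfl hQ₂, hc₁, hc₂,
    nodal_union_of_disjoint α hdW₂, nodal_union_of_disjoint α hdW₁, mul_pow, mul_pow,
    mul_comm (nodal Q₂.vars α ^ k), mul_comm (nodal Q₁.vars α ^ k), mul_assoc, mul_assoc,
    ← mul_add, mul_eq_zero] at hsum
  have hW0 : nodal (Finset.univ \ (Q₁.vars ∪ Q₂.vars)) α ^ k ≠ 0 := pow_ne_zero _ nodal_ne_zero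
  have hkey : nodal Q₂.vars α ^ k * cofactorSum α Q₁.vars Q₁ +
      nodal Q₁.vars α ^ k * cofactorSum α Q₂.vars Q₂ = 0 :=
    hsum.resolve_left hW0
  -- divisibility: `Φ_{V₁}^k ∣ A' · Φ_{V₂}^k`, and `Φ_{V₁}^k`, `Φ_{V₂}^k` are coprime
  have hdvd : nodal Q₁.vars α ^ k ∣ cofactorSum α Q₁.vars Q₁ * nodal Q₂.vars α ^ k := by
    refine ⟨-cofactorSum α Q₂.vars Q₂, ?_⟩
    rw [mul_neg, mul_comm (cofactorSum α Q₁.vars Q₁)]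
    exact eq_neg_of_add_eq_zero_left hkey
  have hcop : IsCoprime (nodal Q₁.vars α ^ k) (nodal Q₂.vars α ^ k) :=
    (isCoprime_nodal_of_disjoint hα hdisj).pow
  have hdvd' : nodal Q₁.vars α ^ k ∣ cofactorSum α Q₁.vars Q₁ := hcop.dvd_of_dvd_mul_right hdvd
  -- degree count: `deg A' ≤ k (|V₁| - 1) < k |V₁|`
  have hA0 : cofactorSum α Q₁.vars Q₁ = 0 := by
    by_contra hA
    have h1 := Polynomial.natDegree_le_of_dvd hdvd' hA
    have h2 := natDegree_cofactorSum_le α (subset_rfl : Q₁.vars ⊆ Q₁.vars) hQ₁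
    rw [Polynomial.natDegree_pow, natDegree_nodal] at h1
    obtain ⟨m, hm⟩ : ∃ m, Q₁.vars.card = m + 1 :=
      Nat.exists_eq_add_one_of_ne_zero
        (Finset.card_pos.mpr (Finset.nonempty_iff_ne_empty.mpr hV₁)).ne'
    rw [hm, Nat.mul_succ] at h1
    rw [hm, Nat.add_sub_cancel] at h2
    omega
  rw [aeval_lagrangeSeed_eq α subset_rfl hQ₁, hA0, mul_zero]

/-- **Minahan–Volkovich 2017, Theorem 20** (with an affine shift `y`; take `y = 0` for the printed
statement "for a non-constant PROP `P`, `P(G_{n,1})` is non-constant"): for distinct nodes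
`α : ι ↪ F`, a preprocessed read-once polynomial `P` whose single-seed image
`P(y_μ + W · L_μ(X)) ∈ F[X][W]` is constant is itself constant.
[cite: MinahanVolkovich2017, Thm. 20] -/
theorem IsPROP.exists_C_of_aeval_lagrangeSingleSeed_eq_C {α : ι → F} (hα : Function.Injective α)
    (y : ι → F) {S : Finset ι} {P : MvPolynomial ι F} (hP : IsPROP S P) {a : F[X]}
    (h : aeval (singleSeed y (lagrangeSeed α)) P = Polynomial.C a) :
    ∃ b : F, P = MvPolynomial.C b :=
  hP.exists_C_of_aeval_singleSeed_eq_C (lagrangeSeed_ne_zero α)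
    (separatesDisjointForms_lagrangeSeed hα) y a h

/-- **Minahan–Volkovich 2017, Theorem 20 (generator form):** for distinct nodes, every NON-ZERO
preprocessed read-once polynomial `P` survives the single-seed Shpilka–Volkovich map,
`P(y_μ + W · L_μ(X)) ≠ 0` — `G_{n,1}` (shifted by any constant point `y`) is a generator for PROPs,
with ONE seed instead of Shpilka–Volkovich's `log n`. [cite: MinahanVolkovich2017, Thm. 20 and Thm. 1] -/
theorem IsPROP.aeval_lagrangeSingleSeed_ne_zero {α : ι → F} (hα : Function.Injective α)
    (y : ι → F) {S : Finset ι} {P : MvPolynomial ι F} (hP : IsPROP S P) (hP0 : P ≠ 0) :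
    aeval (singleSeed y (lagrangeSeed α)) P ≠ 0 :=
  hP.aeval_singleSeed_ne_zero (lagrangeSeed_ne_zero α) (separatesDisjointForms_lagrangeSeed hα)
    y hP0

end Lagrange

end Literature.Computability.AlgebraicComplexity
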